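import Literature.NumberTheory.EllipticCurves.ModularCurvePeriodRatio
import HarnessLib

/-!
# BSD rank-≤1 residual cell: the inline period-unit hypothesis `hϖ` is two EXISTING named facts

HONEST FRAMING (cell `b2b-bsdres-*`, home `run/shared/lean/b2b/bsd-rank1-residual/`, verbatim):
the goal of the cell is to DELETE the COMBINATION-SHAPED residual classes for ALL analytic-rank ≤ 1
curves over ℚ — "full BSD formula for every rank ≤ 1 curve in class C" assembled STRICTLY from
published theorems — so that the rank-≤1 remainder becomes exactly the CONSTRUCTION-SHAPED classes,
which are TYPED (missing-input Props), NOT attempted; this is not "finishing BSD".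

Theorems only; nothing is vendored here (D-0026: no new named fact). Referee ruling R9.4 / flag
`PERIOD-UNIT-inline` (REFEREE.md, gen 5) asked the literature seat to "name the period-unit fact
once": the rank-`0` theorems of the cell at an IRREDUCIBLE prime
(`Summit.….Rank1ResidualX9RankZero.bsdp_of_integralMainConjectureOnClassX9_of_analyticRank_eq_zero`,
x9 seat) and the pre-cell glue they descend from (`padicValRat_bsd_rank_zero_of_facts_cyc` and its
relatives in `LeadingTermPPartProofs`, pub-bsdpct) carry the INLINE hypothesis

  `hϖ : ∀ W p, p ≠ 2 → good(p) → E[p] irreducible → ∀ f (newform of W) ϖ, ϖ · Ω(W) = Ω⁺_f → ord_p ϖ = 0`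

("the `p`-adic unit `ϖ = Ω⁺_f/Ω_E`", cited there to Skinner–Urban 2014 §3.6.7 / Greenberg–Vatsal
2000 §3). The tree ALREADY names this input, as the two facts of `ModularCurvePeriodRatio.lean`
(pub-bsdpct Kurihara lane, pre-cell): `realPeriodRat_eq_unit_mul_plusPeriod` (`p ≥ 5`) and
`realPeriodRat_eq_unit_mul_plusPeriod_three` (`p = 3`) — "`Ω(W) = u · Ω⁺_f` with `u ∈ ℚ`,
`|u|_p = 1`, at a good prime `p` with `E[p]` irreducible" (Greenberg–Vatsal 2000 §3 Remark 3.4 +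
Manin constant prime to `p ∤ N`: Abbes–Ullmo 1996 Thm. A / Mazur 1978 Cor. 4.1 + Edixhoven 1991
Prop. 2; the three-step chain is printed in that file's module docstring). This file proves that the
inline binder FOLLOWS from those two named facts (and nothing else but `Ω(W) > 0`,
`WeierstrassCurve.realPeriod_pos'`), so every consumer can write
`hϖ := periodUnit_of_realPeriodRat_eq_unit_mul_plusPeriod h5 h3` and the cell's inputs table
(HOME/CITED-FACTS.md) lists ONE named input instead of an anonymous binder.

* `padicValRat_eq_zero_of_norm_ratCast_eq_one` — `‖(u : ℚ_[p])‖ = 1 → ord_p u = 0` (arithmetic).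
* `padicValRat_periodRatio_eq_zero_of_eq_unit_mul` — if `Ω(W) = u · Ω⁺_f` with `|u|_p = 1` and
  `ϖ · Ω(W) = Ω⁺_f`, then `ord_p ϖ = 0` (so `ϖ = u⁻¹`; any level `N`).
* `padicValRat_periodRatio_eq_zero_of_five_le` — the binder's conclusion at `p ≥ 5` from
  `realPeriodRat_eq_unit_mul_plusPeriod` alone.
* `padicValRat_periodRatio_eq_zero` — at every odd good irreducible `p`, from both facts.
* `periodUnit_of_realPeriodRat_eq_unit_mul_plusPeriod` — the inline binder `hϖ` VERBATIM (level
  `N_E = W.conductorNorm ℤ`), from both facts.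
-/

noncomputable section

open scoped MatrixGroups ModularForm

open CongruenceSubgroup WeierstrassCurve Literature.NumberTheory.EllipticCurves
  Literature.NumberTheory.EllipticCurves.ModularForms

namespace Literature.NumberTheory.EllipticCurves.Rank1Residual

/-- A nonzero rational number of `p`-adic norm `1` has `p`-adic valuation `0` (and a rational of
norm `1` is nonzero). [folklore] -/
theorem padicValRat_eq_zero_of_norm_ratCast_eq_one {p : ℕ} [Fact p.Prime] {u : ℚ}
    (hu : ‖(u : ℚ_[p])‖ = 1) : padicValRat p u = 0 := by
  have hp : (1 : ℚ) < p := by exact_mod_cast (Fact.out : p.Prime).one_lt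
  have hu0 : u ≠ 0 := by
    rintro rfl
    simp at hu
  rw [Padic.eq_padicNorm, padicNorm.eq_zpow_of_nonzero hu0] at hu
  have h1 : (p : ℚ) ^ (-padicValRat p u) = 1 := by exact_mod_cast hu
  rwa [zpow_eq_one_iff_right₀ (zero_le_one.trans hp.le) hp.ne', neg_eq_zero] at h1

/-- **The period ratio is a `p`-adic unit, from the named comparison.** If the Néron period is a
rational `p`-adic-unit multiple of the lattice period of the newform, `Ω(W) = u · Ω⁺_f` with
`|u|_p = 1` (the CONCLUSION of `realPeriodRat_eq_unit_mul_plusPeriod[_three]` at `(W, p, f)`), then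
every `ϖ ∈ ℚ` with `ϖ · Ω(W) = Ω⁺_f` has `ord_p ϖ = 0` — indeed `ϖ = u⁻¹`, because `Ω(W) > 0`
(`WeierstrassCurve.realPeriod_pos'`) forces `Ω⁺_f ≠ 0`. Any level `N`.
[cite: GreenbergVatsal2000, §3, Remark 3.4] -/
theorem padicValRat_periodRatio_eq_zero_of_eq_unit_mul
    (W : WeierstrassCurve ℚ) [W.IsElliptic] (p : ℕ) [Fact p.Prime]
    {N : ℕ} [NeZero N] (f : CuspForm (Gamma0 N) 2)
    {u : ℚ} (hu : ‖(u : ℚ_[p])‖ = 1) (hΩ : W.realPeriodRat = u * plusPeriod f)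
    (ϖ : ℚ) (hϖ : (ϖ : ℝ) * W.realPeriodRat = plusPeriod f) : padicValRat p ϖ = 0 := by
  have hΩpos : 0 < W.realPeriodRat := by
    haveI : (W.baseChange ℝ).IsElliptic := by rw [baseChange]; infer_instance
    exact (W.baseChange ℝ).realPeriod_pos'
  have hplus : plusPeriod f ≠ 0 := by
    intro h0
    rw [h0, mul_zero] at hΩ
    exact hΩpos.ne' hΩ
  have hprod : ((ϖ * u : ℚ) : ℝ) = 1 := by
    have h1 : ((ϖ : ℝ) * u) * plusPeriod f = 1 * plusPeriod f := by
      rw [one_mul, mul_assoc, ← hΩ, hϖ]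
    push_cast
    exact mul_right_cancel₀ hplus h1
  have hprodQ : ϖ * u = 1 := by exact_mod_cast hprod
  have hu0 : u ≠ 0 := right_ne_zero_of_mul_eq_one hprodQ
  have hϖ0 : ϖ ≠ 0 := left_ne_zero_of_mul_eq_one hprodQ
  have hval : padicValRat p (ϖ * u) = 0 := by rw [hprodQ, padicValRat.one]
  rw [padicValRat.mul hϖ0 hu0, padicValRat_eq_zero_of_norm_ratCast_eq_one hu, add_zero] at hval
  exact hval

/-- **`ord_p(Ω⁺_f/Ω_E) = 0` at a good prime `p ≥ 5` with `E[p]` irreducible**, from the named fact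
`realPeriodRat_eq_unit_mul_plusPeriod` ALONE (Greenberg–Vatsal 2000 §3 Remark 3.4; Manin constant
prime to `p ∤ N`: Abbes–Ullmo 1996 Thm. A; Edixhoven 1991 Prop. 2): for `W/ℚ` globally minimal
elliptic, its newform `f` (any level) and `ϖ ∈ ℚ` with `ϖ · Ω(W) = Ω⁺_f`, `ord_p ϖ = 0`.
[cite: GreenbergVatsal2000, §3, Remark 3.4; AbbesUllmo1996, Thm. A; EdixhovenManin1991, Prop. 2 and §1] -/
theorem padicValRat_periodRatio_eq_zero_of_five_le (h5 : realPeriodRat_eq_unit_mul_plusPeriod)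
    (W : WeierstrassCurve ℚ) [W.IsElliptic] [W.IsGloballyMinimal] (p : ℕ) [Fact p.Prime]
    (hp : 5 ≤ p) (hgood : W.HasGoodReductionAtPrime p) (hirr : W.HasIrreducibleModPGaloisRep p)
    {N : ℕ} [NeZero N] (f : CuspForm (Gamma0 N) 2) (hf : IsNewformOf W f)
    (ϖ : ℚ) (hϖ : (ϖ : ℝ) * W.realPeriodRat = plusPeriod f) : padicValRat p ϖ = 0 := by
  obtain ⟨u, hu, hΩ⟩ := h5 W p hp hgood hirr f hf
  exact padicValRat_periodRatio_eq_zero_of_eq_unit_mul W p f hu hΩ ϖ hϖ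

/-- **`ord_p(Ω⁺_f/Ω_E) = 0` at every ODD good prime `p` with `E[p]` irreducible**, from the two
named facts `realPeriodRat_eq_unit_mul_plusPeriod` (`p ≥ 5`) and
`realPeriodRat_eq_unit_mul_plusPeriod_three` (`p = 3`; Manin constant at `3 ∤ N` by Mazur 1978
Cor. 4.1): for `W/ℚ` globally minimal elliptic, `p ≠ 2` of good reduction with `ρ̄_{E,p}`
irreducible, its newform `f` (any level) and `ϖ ∈ ℚ` with `ϖ · Ω(W) = Ω⁺_f`, `ord_p ϖ = 0`.
[cite: GreenbergVatsal2000, §3, Remark 3.4; AbbesUllmo1996, Thm. A; Mazur1978, Cor. 4.1; EdixhovenManin1991, Prop. 2 and §1] -/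
theorem padicValRat_periodRatio_eq_zero (h5 : realPeriodRat_eq_unit_mul_plusPeriod)
    (h3 : realPeriodRat_eq_unit_mul_plusPeriod_three)
    (W : WeierstrassCurve ℚ) [W.IsElliptic] [W.IsGloballyMinimal] (p : ℕ) [Fact p.Prime]
    (hp : p ≠ 2) (hgood : W.HasGoodReductionAtPrime p) (hirr : W.HasIrreducibleModPGaloisRep p)
    {N : ℕ} [NeZero N] (f : CuspForm (Gamma0 N) 2) (hf : IsNewformOf W f)
    (ϖ : ℚ) (hϖ : (ϖ : ℝ) * W.realPeriodRat = plusPeriod f) : padicValRat p ϖ = 0 := by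
  rcases Nat.lt_or_ge p 5 with hlt | hge
  · have hpP : p.Prime := Fact.out
    have h2 := hpP.two_le
    have hp3 : p = 3 := by
      interval_cases p
      · exact absurd rfl hp
      · rfl
      · exact absurd hpP (by decide)
    subst hp3
    obtain ⟨u, hu, hΩ⟩ := h3 W hgood hirr f hf
    exact padicValRat_periodRatio_eq_zero_of_eq_unit_mul W 3 f hu hΩ ϖ hϖ
  · exact padicValRat_periodRatio_eq_zero_of_five_le h5 W p hge hgood hirr f hf ϖ hϖ

/-- **The inline binder `hϖ`, verbatim, from the two named facts.** This is EXACTLY the hypothesis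
`hϖ` of `padicValRat_bsd_rank_zero_of_facts_cyc` (`LeadingTermPPartProofs`) and of
`Rank1ResidualX9RankZero.bsdp_of_integralMainConjectureOnClassX9_of_analyticRank_eq_zero` (level
`N_E = W.conductorNorm ℤ`): so the "period unit at an irreducible prime" input of the cell's rank-`0`
theorems is the pair of named facts `realPeriodRat_eq_unit_mul_plusPeriod`,
`realPeriodRat_eq_unit_mul_plusPeriod_three` (referee flag `PERIOD-UNIT-inline`, R9.4).
[cite: GreenbergVatsal2000, §3, Remark 3.4; AbbesUllmo1996, Thm. A; Mazur1978, Cor. 4.1; EdixhovenManin1991, Prop. 2 and §1] -/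
theorem periodUnit_of_realPeriodRat_eq_unit_mul_plusPeriod
    (h5 : realPeriodRat_eq_unit_mul_plusPeriod) (h3 : realPeriodRat_eq_unit_mul_plusPeriod_three) :
    ∀ (W : WeierstrassCurve ℚ) [W.IsElliptic] [W.IsGloballyMinimal] (p : ℕ) [Fact p.Prime],
      p ≠ 2 → W.HasGoodReductionAtPrime p → W.HasIrreducibleModPGaloisRep p →
      ∀ [NeZero (W.conductorNorm ℤ)] (f : CuspForm (Gamma0 (W.conductorNorm ℤ)) 2),
        IsNewformOf W f →
      ∀ ϖ : ℚ, (ϖ : ℝ) * W.realPeriodRat = plusPeriod f → padicValRat p ϖ = 0 :=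
  fun W _ _ p _ hp hgood hirr _ f hf ϖ hϖ =>
    padicValRat_periodRatio_eq_zero h5 h3 W p hp hgood hirr f hf ϖ hϖ

end Literature.NumberTheory.EllipticCurves.Rank1Residual

end
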